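import Literature.Combinatorics.LorentzianPolynomials.ProductLorentzian
import Literature.Combinatorics.LorentzianPolynomials.Bivariate
import HarnessLib

/-!
# Liggett's theorem: the convolution of ultra log-concave sequences with no internal zeros is ultra log-concave
# (Brändén–Huh 2020, §2.5, after Cor. 2.32; Liggett 1997)

Layer `Literature/Combinatorics/LorentzianPolynomials`, namespace `Literature.Combinatorics.LorentzianPolynomials`;
lane `lit-hodgefound` (Track 2 foundations library), seat p16, generation 28 (row g28-#11). Brändén–Huh remark that
Corollary 2.32 (products of Lorentzian polynomials are Lorentzian, `ProductLorentzian.lean`) "extends the following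
theorem of Liggett [Liggett]: The convolution product of two ultra log-concave sequences with no internal zeros is an
ultra log-concave sequence with no internal zeros." This file carries out that deduction: a nonnegative sequence
`a_0, …, a_d` is ultra log-concave (of order `d`) with no internal zeros iff `Σ_k a_k X_0^k X_1^{d-k}` is Lorentzian
(Example 2.26, `bivariate_mem_lorentzian_iff`); the product of the two bivariate polynomials is the bivariate polynomial of
the convolution `(a ⋆ b)_k = Σ_{i+j=k} a_i b_j` (`bivariate_mul_bivariate`), of degree `d + e`; and it is Lorentzian by
Cor. 2.32 (`mul_mem_lorentzian`). (Liggett's theorem in [Liggett1997] is stated for `ULC(l)`/`ULC(d)` sequences of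
possibly shorter length and without the internal-zeros proviso; the version here is the one printed by Brändén–Huh,
orders = lengths.)

## Sources (verbatim)

* P. Brändén, J. Huh, *Lorentzian polynomials* [BrandenHuh2019] (held `paper:arxiv-1902.03719`), §2.5 after Cor. 2.32:
  "Corollary 2.32 extends the following theorem of Liggett [Liggett]: The convolution product of two ultra log-concave
  sequences with no internal zeros is an ultra log-concave sequence with no internal zeros." §2.4 Example 2.26: "a
  bivariate homogeneous polynomial `Σ_{k=0}^d a_k w_1^k w_2^{d-k}` […] is Lorentzian if and only if the sequence `a_k` is
  nonnegative, ultra log-concave, and has no internal zeros."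
* L. Gurvits, *A short proof, based on mixed volumes, of Liggett's theorem …* [Gurvits2009Liggett] (held
  `paper:arxiv-0804.1181`), §1: "Let `a = (a_0, …, a_m)` and `b = (b_0, …, b_n)` be two real sequences. Their convolution
  `c = a ⋆ b` is defined as `c_k = Σ_{i+j=k} a_i b_j`, `0 ≤ k ≤ n + m`. […] The next result was conjectured by R. Pemantle
  and proved by T.M. Liggett in 1997 [lig]. **Theorem.** The convolution of a `ULC(l)` sequence `a` and a `ULC(d)` sequence
  `b` is `ULC(l+d)`."

## What is here

* `seqConv d e a b k = Σ_{i ≤ d, j ≤ e, i+j=k} a_i b_j` (the convolution of `(a_0,…,a_d)` and `(b_0,…,b_e)`), `seqConv_nonneg`;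
* **`bivariate_mul_bivariate`**: `(Σ_i a_i X_0^i X_1^{d-i}) · (Σ_j b_j X_0^j X_1^{e-j}) = Σ_k (a ⋆ b)_k X_0^k X_1^{d+e-k}`;
* **`isUltraLogConcave_seqConv`** / `hasNoInternalZeros_seqConv` (Liggett's theorem in Brändén–Huh's form) and the
  combined `ultraLogConcave_convolution`.

One definition with body (`seqConv`), theorems otherwise; no `sorry`, no named fact (net debt 0).

## References

* [BrandenHuh2019] P. Brändén, J. Huh, *Lorentzian polynomials*, Ann. of Math. (2) 192 (2020) 821–891, arXiv:1902.03719 —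
  §2.5 Cor. 2.32 and the remark after it; §2.4 Example 2.26.
* [Liggett1997] T. M. Liggett, *Ultra logconcave sequences and negative dependence*, J. Combin. Theory Ser. A 79 (1997)
  315–325 — the convolution theorem (conjectured by Pemantle).
* [Gurvits2009Liggett] L. Gurvits, *A short proof, based on mixed volumes, of Liggett's theorem on the convolution of
  ultra-logconcave sequences*, Electron. J. Combin. 16 (2009), arXiv:0804.1181 — §1 (statement of Liggett's theorem).
-/

noncomputable section

open MvPolynomial Finsupp Finset
open scoped Nat

namespace Literature.Combinatorics.LorentzianPolynomials

/-! ## §1 The convolution of two finite sequences -/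

/-- **The convolution `(a ⋆ b)_k = Σ_{i+j=k} a_i b_j`** of the sequences `(a_0, …, a_d)` and `(b_0, …, b_e)` (entries of `a`,
`b` beyond `d`, `e` are ignored). [cite: Gurvits2009Liggett, §1 ("`c_k = Σ_{i+j=k} a_i b_j, 0 ≤ k ≤ n+m`")]
[cite: BrandenHuh2019, §2.5 (after Cor. 2.32, "convolution product")] -/
def seqConv (d e : ℕ) (a b : ℕ → ℝ) (k : ℕ) : ℝ :=
  ∑ i ∈ range (d + 1), ∑ j ∈ range (e + 1), if i + j = k then a i * b j else 0

/-- Unfolding `seqConv`. [cite: Gurvits2009Liggett, §1] -/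
theorem seqConv_def (d e : ℕ) (a b : ℕ → ℝ) (k : ℕ) :
    seqConv d e a b k = ∑ i ∈ range (d + 1), ∑ j ∈ range (e + 1), if i + j = k then a i * b j else 0 := rfl

/-- The convolution of nonnegative sequences is nonnegative. [cite: Gurvits2009Liggett, §1] -/
theorem seqConv_nonneg {d e : ℕ} {a b : ℕ → ℝ} (ha : ∀ k ≤ d, 0 ≤ a k) (hb : ∀ k ≤ e, 0 ≤ b k) (k : ℕ) :
    0 ≤ seqConv d e a b k :=
  Finset.sum_nonneg fun i hi ↦ Finset.sum_nonneg fun j hj ↦ by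
    split_ifs
    · exact mul_nonneg (ha i (by have := Finset.mem_range.1 hi; omega)) (hb j (by have := Finset.mem_range.1 hj; omega))
    · exact le_rfl

/-! ## §2 The product of two bivariate polynomials -/

/-- The coefficient of `X_0^k X_1^{d+e-k}` in `(Σ_i a_i X_0^i X_1^{d-i})(Σ_j b_j X_0^j X_1^{e-j})` is `(a ⋆ b)_k`.
[cite: BrandenHuh2019, §2.5 proof of Cor. 2.32 with §2.4 Example 2.26] -/
theorem coeff_bivariate_mul_bivariate (d e : ℕ) (a b : ℕ → ℝ) (k : ℕ) :
    coeff (bideg k (d + e - k)) (bivariate d a * bivariate e b) = seqConv d e a b k := by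
  rw [bivariate_def, bivariate_def, Finset.sum_mul, coeff_sum, seqConv]
  refine Finset.sum_congr rfl fun i hi ↦ ?_
  rw [Finset.mul_sum, coeff_sum]
  refine Finset.sum_congr rfl fun j hj ↦ ?_
  have hi' := Finset.mem_range.1 hi
  have hj' := Finset.mem_range.1 hj
  rw [monomial_mul, coeff_monomial, bideg_add_bideg]
  exact if_congr (bideg_eq_bideg_iff.trans ⟨fun h ↦ h.1, fun h ↦ ⟨h, by omega⟩⟩) rfl rfl

/-- **`(Σ_i a_i X_0^i X_1^{d-i}) · (Σ_j b_j X_0^j X_1^{e-j}) = Σ_k (a ⋆ b)_k X_0^k X_1^{d+e-k}`**: the product of the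
bivariate polynomials of two sequences is the bivariate polynomial of their convolution.
[cite: BrandenHuh2019, §2.5 (after Cor. 2.32); §2.4 Example 2.26] -/
theorem bivariate_mul_bivariate (d e : ℕ) (a b : ℕ → ℝ) :
    bivariate d a * bivariate e b = bivariate (d + e) (seqConv d e a b) := by
  have hhom : (bivariate d a * bivariate e b).IsHomogeneous (d + e) :=
    (isHomogeneous_bivariate d a).mul (isHomogeneous_bivariate e b)
  rw [eq_bivariate_of_isHomogeneous hhom]
  rw [bivariate_def _ (fun k ↦ coeff _ _), bivariate_def _ (seqConv d e a b)]
  refine Finset.sum_congr rfl fun k _ ↦ ?_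
  rw [coeff_bivariate_mul_bivariate]

/-! ## §3 Liggett's theorem -/

/-- **Liggett's theorem (Brändén–Huh's form, via Cor. 2.32): the convolution of two nonnegative ultra log-concave
sequences with no internal zeros — `(a_0, …, a_d)` of order `d` and `(b_0, …, b_e)` of order `e` — is ultra log-concave of
order `d + e` with no internal zeros.** Proof: the two bivariate polynomials are Lorentzian (Example 2.26), so is their
product (Cor. 2.32), which is the bivariate polynomial of the convolution. [cite: BrandenHuh2019, §2.5 (after Cor. 2.32:
"The convolution product of two ultra log-concave sequences with no internal zeros is an ultra log-concave sequence with
no internal zeros"); §2.4 Example 2.26] [cite: Liggett1997, the convolution theorem (J. Combin. Theory Ser. A 79, p. 315)] -/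
theorem ultraLogConcave_convolution {d e : ℕ} {a b : ℕ → ℝ} (ha : ∀ k ≤ d, 0 ≤ a k) (hb : ∀ k ≤ e, 0 ≤ b k)
    (hau : IsUltraLogConcave d a) (haz : HasNoInternalZeros d a) (hbu : IsUltraLogConcave e b)
    (hbz : HasNoInternalZeros e b) :
    IsUltraLogConcave (d + e) (seqConv d e a b) ∧ HasNoInternalZeros (d + e) (seqConv d e a b) := by
  have hA : bivariate d a ∈ lorentzian (Fin 2) d := (bivariate_mem_lorentzian_iff ha).2 ⟨hau, haz⟩
  have hB : bivariate e b ∈ lorentzian (Fin 2) e := (bivariate_mem_lorentzian_iff hb).2 ⟨hbu, hbz⟩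
  have hAB := mul_mem_lorentzian hA hB
  rw [bivariate_mul_bivariate] at hAB
  exact (bivariate_mem_lorentzian_iff fun k _ ↦ seqConv_nonneg ha hb k).1 hAB

/-- Liggett's theorem, the ultra-log-concavity conclusion: `(a ⋆ b)_k² / C(d+e,k)² ≥ (a ⋆ b)_{k-1}/C(d+e,k-1) ·
(a ⋆ b)_{k+1}/C(d+e,k+1)` for `0 < k < d + e`. [cite: BrandenHuh2019, §2.5 (after Cor. 2.32)]
[cite: Gurvits2009Liggett, §1 ("The convolution of a `ULC(l)` sequence `a` and a `ULC(d)` sequence `b` is `ULC(l+d)`")] -/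
theorem isUltraLogConcave_seqConv {d e : ℕ} {a b : ℕ → ℝ} (ha : ∀ k ≤ d, 0 ≤ a k) (hb : ∀ k ≤ e, 0 ≤ b k)
    (hau : IsUltraLogConcave d a) (haz : HasNoInternalZeros d a) (hbu : IsUltraLogConcave e b)
    (hbz : HasNoInternalZeros e b) : IsUltraLogConcave (d + e) (seqConv d e a b) :=
  (ultraLogConcave_convolution ha hb hau haz hbu hbz).1

/-- … and the convolution has no internal zeros. [cite: BrandenHuh2019, §2.5 (after Cor. 2.32)] -/
theorem hasNoInternalZeros_seqConv {d e : ℕ} {a b : ℕ → ℝ} (ha : ∀ k ≤ d, 0 ≤ a k) (hb : ∀ k ≤ e, 0 ≤ b k)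
    (hau : IsUltraLogConcave d a) (haz : HasNoInternalZeros d a) (hbu : IsUltraLogConcave e b)
    (hbz : HasNoInternalZeros e b) : HasNoInternalZeros (d + e) (seqConv d e a b) :=
  (ultraLogConcave_convolution ha hb hau haz hbu hbz).2

end Literature.Combinatorics.LorentzianPolynomials

end
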